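import Mathlib.Analysis.Calculus.Deriv.Inv
import Mathlib.Analysis.Calculus.Deriv.Add
import Mathlib.Analysis.Calculus.Deriv.Mul
import Mathlib.Algebra.Order.BigOperators.Group.Finset
import Mathlib.Algebra.BigOperators.Ring.Finset
import Mathlib.Analysis.SpecialFunctions.Pow.Real

/-!
# Handoff (rh-explicit, prove-1), Route E: the Loewner kernel of a finite Pick partial fraction
(the algebraic core of LEMMA KS / LEMMA C of handoff/prove-1 ATTEMPT-14)

For poles `t k` and weights `w k` indexed by a finite set `s`, the partial fraction
`g(x) = ∑_{k ∈ s} w k · x / (t k + x)` (a Pick / operator-monotone function on `(0, ∞)` when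
`w, t ≥ 0`) has the divided differences

  `(g x - g y) / (x - y) = ∑_{k ∈ s} w k · t k / ((t k + x)(t k + y))`   (`x ≠ y`),

and derivative `g' x = ∑ w k · t k / (t k + x)²`, so its LOEWNER KERNEL
`K x y := ∑ w k · t k / ((t k + x)(t k + y))` (divided differences off the diagonal, the derivative on it)
is a GRAM kernel: for every real vector `c` and nodes `x j`,

  `∑_j ∑_l c j · c l · K (x j) (x l) = ∑_{k ∈ s} w k · t k · (∑_j c j / (t k + x j))²`,

hence it is non-negative when `w k · t k ≥ 0`, and it DOMINATES the same sum over any subfamily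
`s' ⊆ s` (the "Cauchy minor" inequality of ATTEMPT-14 LEMMA C (a)). In the application `g` is the
Kneser–Sommerfeld expansion `√x·I_{ν+1}(√x)/I_ν(√x) = ∑_k 2x/(j_{ν,k}² + x)` (there an infinite sum; every
finite truncation is an instance of this file, and the quadratic form of the full sum is the monotone limit),
`K` is the Gram matrix of the shifted Kaiser–Bessel windows divided by `S²·I_ν(z_j)I_ν(z_l)` (Lommel), and
the subfamily bound feeds the closed-form lower bound for the least eigenvalue. Nothing here bears on RH
(finite-dimensional real algebra). [folklore: Loewner matrices of Pick functions; Cauchy/Gram structure]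
-/

set_option linter.dupNamespace false

noncomputable section

open Finset

namespace Summit.RiemannHypothesis.RiemannHypothesis.Theorems.HandoffLoewnerKernel

variable {ι : Type*}

/-! Throughout, `g x := ∑ k ∈ s, w k * (x / (t k + x))` (the finite Pick partial fraction) and
`K x y := ∑ k ∈ s, w k * t k / ((t k + x) * (t k + y))` (its Loewner kernel) are written out in full
(no definitions are introduced). -/

/-- The kernel is symmetric. [elementary] -/
theorem loewnerKernel_comm (s : Finset ι) (w t : ι → ℝ) (x y : ℝ) :
    (∑ k ∈ s, w k * t k / ((t k + x) * (t k + y))) = (∑ k ∈ s, w k * t k / ((t k + y) * (t k + x))) := by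
  refine Finset.sum_congr rfl fun k _ => ?_
  rw [mul_comm (t k + x) (t k + y)]

/-- One pole: `x/(t+x) - y/(t+y) = t·(x - y)/((t+x)(t+y))`. [elementary] -/
theorem div_sub_div_pole {t x y : ℝ} (hx : t + x ≠ 0) (hy : t + y ≠ 0) :
    x / (t + x) - y / (t + y) = t * (x - y) / ((t + x) * (t + y)) := by
  rw [div_sub_div _ _ hx hy]
  congr 1
  ring

/-- DIVIDED DIFFERENCES: `g x - g y = (x - y) · K x y` (no division, valid also for `x = y`).
[elementary] -/
theorem pickSum_sub (s : Finset ι) (w t : ι → ℝ) {x y : ℝ}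
    (hx : ∀ k ∈ s, t k + x ≠ 0) (hy : ∀ k ∈ s, t k + y ≠ 0) :
    (∑ k ∈ s, w k * (x / (t k + x))) - (∑ k ∈ s, w k * (y / (t k + y)))
      = (x - y) * (∑ k ∈ s, w k * t k / ((t k + x) * (t k + y))) := by
  rw [← Finset.sum_sub_distrib, Finset.mul_sum]
  refine Finset.sum_congr rfl fun k hk => ?_
  rw [← mul_sub, div_sub_div_pole (hx k hk) (hy k hk)]
  field_simp

/-- The Loewner matrix entry off the diagonal: `(g x - g y)/(x - y) = K x y` for `x ≠ y`. [elementary] -/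
theorem pickSum_divDiff (s : Finset ι) (w t : ι → ℝ) {x y : ℝ}
    (hx : ∀ k ∈ s, t k + x ≠ 0) (hy : ∀ k ∈ s, t k + y ≠ 0) (hxy : x ≠ y) :
    ((∑ k ∈ s, w k * (x / (t k + x))) - (∑ k ∈ s, w k * (y / (t k + y)))) / (x - y)
      = (∑ k ∈ s, w k * t k / ((t k + x) * (t k + y))) := by
  rw [pickSum_sub s w t hx hy, mul_div_cancel_left₀ _ (sub_ne_zero.2 hxy)]

/-- One pole, derivative: `d/dx [x/(t+x)] = t/(t+x)²` at a point with `t + x ≠ 0`. [elementary] -/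
theorem hasDerivAt_div_pole {t x : ℝ} (hx : t + x ≠ 0) :
    HasDerivAt (fun y : ℝ => y / (t + y)) (t / ((t + x) * (t + x))) x := by
  have hden : HasDerivAt (fun y : ℝ => t + y) 1 x := by
    simpa using (hasDerivAt_id x).const_add t
  have h := (hasDerivAt_id x).div hden hx
  refine h.congr_deriv ?_
  rw [sq]
  field_simp
  simp

/-- The Loewner matrix entry ON the diagonal: `g' x = K x x`. [elementary] -/
theorem hasDerivAt_pickSum (s : Finset ι) (w t : ι → ℝ) {x : ℝ} (hx : ∀ k ∈ s, t k + x ≠ 0) :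
    HasDerivAt (fun y : ℝ => ∑ k ∈ s, w k * (y / (t k + y))) (∑ k ∈ s, w k * t k / ((t k + x) * (t k + x))) x := by
  have : HasDerivAt (fun y => ∑ k ∈ s, w k * (y / (t k + y)))
      (∑ k ∈ s, w k * (t k / ((t k + x) * (t k + x)))) x :=
    HasDerivAt.fun_sum fun k hk => (hasDerivAt_div_pole (hx k hk)).const_mul (w k)
  convert this using 2 with k
  ring

/-- GRAM STRUCTURE of the Loewner kernel: for every finite family of nodes `x j` and coefficients `c j`,
`∑_j ∑_l c j · c l · K (x j) (x l) = ∑_{k ∈ s} w k · t k · (∑_j c j / (t k + x j))²`.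
(All denominators are required to be non-zero.) [elementary] -/
theorem loewnerKernel_quadratic {κ : Type*} (J : Finset κ) (c x : κ → ℝ)
    (s : Finset ι) (w t : ι → ℝ) (h : ∀ k ∈ s, ∀ j ∈ J, t k + x j ≠ 0) :
    ∑ j ∈ J, ∑ l ∈ J, c j * c l * (∑ k ∈ s, w k * t k / ((t k + x j) * (t k + x l)))
      = ∑ k ∈ s, w k * t k * (∑ j ∈ J, c j / (t k + x j)) ^ 2 := by
  calc ∑ j ∈ J, ∑ l ∈ J, c j * c l * (∑ k ∈ s, w k * t k / ((t k + x j) * (t k + x l)))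
      = ∑ j ∈ J, ∑ l ∈ J, ∑ k ∈ s, w k * t k * ((c j / (t k + x j)) * (c l / (t k + x l))) := by
        refine Finset.sum_congr rfl fun j hj => Finset.sum_congr rfl fun l hl => ?_
        rw [Finset.mul_sum]
        refine Finset.sum_congr rfl fun k hk => ?_
        have hj' := h k hk j hj
        have hl' := h k hk l hl
        field_simp
    _ = ∑ j ∈ J, ∑ k ∈ s, ∑ l ∈ J, w k * t k * ((c j / (t k + x j)) * (c l / (t k + x l))) := by
        refine Finset.sum_congr rfl fun j _ => ?_
        rw [Finset.sum_comm]
    _ = ∑ k ∈ s, ∑ j ∈ J, ∑ l ∈ J, w k * t k * ((c j / (t k + x j)) * (c l / (t k + x l))) := by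
        rw [Finset.sum_comm]
    _ = ∑ k ∈ s, w k * t k * (∑ j ∈ J, c j / (t k + x j)) ^ 2 := by
        refine Finset.sum_congr rfl fun k _ => ?_
        rw [sq, Finset.sum_mul_sum, Finset.mul_sum]
        refine Finset.sum_congr rfl fun j _ => ?_
        rw [Finset.mul_sum]

/-- POSITIVITY: with non-negative `w k · t k` the Loewner quadratic form is `≥ 0`. [elementary] -/
theorem loewnerKernel_quadratic_nonneg {κ : Type*} (J : Finset κ) (c x : κ → ℝ)
    (s : Finset ι) (w t : ι → ℝ) (h : ∀ k ∈ s, ∀ j ∈ J, t k + x j ≠ 0)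
    (hwt : ∀ k ∈ s, 0 ≤ w k * t k) :
    0 ≤ ∑ j ∈ J, ∑ l ∈ J, c j * c l * (∑ k ∈ s, w k * t k / ((t k + x j) * (t k + x l))) := by
  rw [loewnerKernel_quadratic J c x s w t h]
  exact Finset.sum_nonneg fun k hk => mul_nonneg (hwt k hk) (sq_nonneg _)

/-- THE MINOR INEQUALITY (ATTEMPT-14 LEMMA C (a), finite form): keeping only the poles of a subfamily
`s' ⊆ s` can only DECREASE the Loewner quadratic form (when `w k · t k ≥ 0`); in particular any lower
bound for the least eigenvalue of the `s'`-kernel is one for the `s`-kernel. [elementary] -/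
theorem loewnerKernel_quadratic_mono {κ : Type*} (J : Finset κ) (c x : κ → ℝ)
    {s' s : Finset ι} (hss : s' ⊆ s) (w t : ι → ℝ) (h : ∀ k ∈ s, ∀ j ∈ J, t k + x j ≠ 0)
    (hwt : ∀ k ∈ s, 0 ≤ w k * t k) :
    ∑ j ∈ J, ∑ l ∈ J, c j * c l * (∑ k ∈ s', w k * t k / ((t k + x j) * (t k + x l)))
      ≤ ∑ j ∈ J, ∑ l ∈ J, c j * c l * (∑ k ∈ s, w k * t k / ((t k + x j) * (t k + x l))) := by
  rw [loewnerKernel_quadratic J c x s w t h,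
    loewnerKernel_quadratic J c x s' w t fun k hk j hj => h k (hss hk) j hj]
  exact Finset.sum_le_sum_of_subset_of_nonneg hss fun k hk _ =>
    mul_nonneg (hwt k hk) (sq_nonneg _)

/-- Convenience: on `(0, ∞)` with positive poles all denominators are automatically non-zero, and the
three statements above apply; e.g. the Gram identity. [elementary] -/
theorem loewnerKernel_quadratic_of_pos {κ : Type*} (J : Finset κ) (c x : κ → ℝ)
    (s : Finset ι) (w t : ι → ℝ) (ht : ∀ k ∈ s, 0 < t k) (hx : ∀ j ∈ J, 0 ≤ x j) :
    ∑ j ∈ J, ∑ l ∈ J, c j * c l * (∑ k ∈ s, w k * t k / ((t k + x j) * (t k + x l)))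
      = ∑ k ∈ s, w k * t k * (∑ j ∈ J, c j / (t k + x j)) ^ 2 :=
  loewnerKernel_quadratic J c x s w t fun k hk j hj => (add_pos_of_pos_of_nonneg (ht k hk) (hx j hj)).ne'

end Summit.RiemannHypothesis.RiemannHypothesis.Theorems.HandoffLoewnerKernel

end
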